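import Mathlib
import Literature.AlgebraicGeometry.Resolution.Lipman1969H1Domination
import HarnessLib

/-!
# Domination of a desingularization and a proper model by quadratic transformations
# (Lipman 1969, proof of Proposition (1.2), statement B) — a special case of Theorem (26.1), Zariski's
# elimination of indeterminacies), and Proposition (1.2) 2) MODULO it

Topic: `Literature/AlgebraicGeometry/Resolution`.  NAMED FACT (D-0014), typed from the printed page of
J. Lipman, *Rational singularities, with applications to algebraic surfaces and unique factorization*,
Publ. Math. IHÉS 36 (1969) 195–279 (held copy `paper:doi-10-1007-bf02684604`, read on the page: PDF p. 7 =
printed p. 200, PDF p. 81 = printed p. 274), continuing `Lipman1969RationalSurfaceSingularities`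
(`HasRationalSingularity`, `HasTrivialCechH1`, `Lipman1969_1_2`) and `Lipman1969H1Domination` (the fact-free
steps A) and «canonical injection» of the same proof) in this directory's vocabulary (`IsResolution`,
`IsBirational`).

## The source (quoted from the printed paper)

Proof of Proposition (1.2), p. 200: «The proposition follows from two familiar facts: A) If `X` is any regular
surface and `j : Z → X` is a quadratic transformation, then `H¹(Z, 𝒪_Z) ≅ H¹(X, 𝒪_X)`.  **B) Let
`f : X → Spec(R)` be a desingularization.  If `g` is proper, then there exists a commutative diagram of proper
birational maps `h : Z → W`, `j : Z → X`, `g : W → Spec(R)`, `f : X → Spec(R)` with `j` a product of (i.e.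
succession of) quadratic transformations.** A) is proved in [20, pp. 59-61] …  B) is a special case of Theorem
(26.1) of the Appendix («elimination of indeterminacies»).»  (Here `g : W → Spec(R)` is the «birational map of
finite type» of the statement of (1.2), `R` a two-dimensional normal local ring having a rational singularity.)

Theorem (26.1) (Zariski), p. 274: «Let `φ : X → Y` be an `S`-rational transformation, where `X`, `Y` and `S`
are as in the beginning of this section [`X` a surface, `Y` separated of finite type over `S`].  Then there
exists a birational closed map `f : X' → X` which is obtained as a succession of normalizations and quadratic
transformations such that the `S`-rational transformation `φ ∘ f` has no points of indeterminacy.»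

## What is vendored, and in which vocabulary

* `Lipman1969_1_2_B` — statement B), for `R` a normal Noetherian local domain of Krull dimension `2` (the
  standing hypothesis of (1.2); no rationality is needed for B)), a desingularization `f : X → Spec R`
  (`IsResolution`) and `g : W → Spec R` proper and birational with `W` integral: there are `Z`, `j : Z → X`,
  `h : Z → W` with `h ≫ g = j ≫ f` and `j` a resolution (proper, birational, `Z` regular).  WEAKER than print
  in the conclusion only: «`j` a product of quadratic transformations» of the regular surface `X` implies that
  `j` is proper and birational with regular source, which is all the consumers use (the tree has quadratic
  transformations — `Resolution/QuadraticTransforms*`, `BlowupClosedPointRegularSurface` — but no predicate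
  «is a finite succession of point blow-ups» for a morphism of schemes).
* `Lipman1969_1_2_B.hasTrivialCechH1_of_isProper` (PROVED modulo B)) — **Proposition (1.2) 2)** in print
  generality: `W` normal integral, `g` proper birational ⇒ `H¹(W, 𝒪_W) = 0`; Lipman's proof verbatim over the
  fact-free `Lipman1969H1Domination` (A) globally + the canonical injection).
* `Lipman1969_1_2_B.hasTrivialCechH1_of_isResolution` — the consumed shape of
  `Lipman1969_1_2.hasTrivialCechH1_of_isResolution` (`RationalSurfaceSingularitiesBasic`): every
  desingularization of a rational `R` has `H¹ = 0`, now modulo B) instead of (1.2).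

VACUITY: `Lipman1969_1_2_B` is not decided by unfolding; its hypotheses are satisfiable (`R = k[[x,y]]`-like
regular local rings of dimension `2`, `X = W = Spec R`: then `Z = X` works, so the fact is TRUE there trivially;
a non-trivial instance is `X = Spec R` regular, `W = Bl_𝔪 Spec R`, where `Z = W`, `j` the blow-up).

## What is NOT here

The proof of B) / Theorem (26.1) (exceptional valuations, Zariski's Main Theorem, the union argument of
Theorem (26.2), p. 274); Theorem (26.1) itself for arbitrary surfaces `X` (normalizations interleaved) and
arbitrary `S`-rational transformations; part 1) of Proposition (1.2).
`-- TODO(general form):` Theorem (26.1) for every surface `X` and every `S`-rational transformation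
`φ : X ⇢ Y` to a separated `S`-scheme of finite type, with `f` a succession of normalizations and quadratic
transformations.

## References
* J. Lipman, Publ. Math. IHÉS 36 (1969): Prop. (1.2) (p. 199) and its proof, statements A), B) (p. 200);
  Appendix §26, Theorems (26.1), (26.2) (p. 274). [Lipman1969]
* O. Zariski, *Reduction of the singularities of algebraic three dimensional varieties*, Ann. of Math. 45
  (1944) (the original elimination of indeterminacies / fundamental points). [Zariski1944]
-/

noncomputable section

open CategoryTheory CategoryTheory.Limits AlgebraicGeometry TopologicalSpace IsLocalRing
open Literature.AlgebraicGeometry.Morphisms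

universe u

namespace Literature.AlgebraicGeometry.Resolution

/-! ## Statement B) -/

/-- NAMED FACT — **Lipman 1969, proof of Proposition (1.2), statement B)** («Let `f : X → Spec(R)` be a
desingularization.  If `g` is proper, then there exists a commutative diagram of proper birational maps
`h : Z → W`, `j : Z → X` [over `Spec(R)`] with `j` a product of (i.e. succession of) quadratic
transformations»; «B) is a special case of Theorem (26.1) of the Appendix (elimination of indeterminacies)»).
Rendered for `R` a normal Noetherian local domain of Krull dimension `2`, `f : X → Spec R` a resolution
(`IsResolution`), `g : W → Spec R` proper and birational with `W` integral: there exist `Z`, `j : Z → X`,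
`h : Z → W` with `h ≫ g = j ≫ f` and `j` a resolution of `X` (proper, birational, `Z` regular — what «a
product of quadratic transformations of the regular surface `X`» gives).  Users take `(h : Lipman1969_1_2_B)`.
[cite: Lipman1969, Proposition (1.2), proof, statement B) (p. 200); Theorem (26.1) (p. 274)] -/
def Lipman1969_1_2_B : Prop :=
  ∀ (R : Type u) [CommRing R] [IsNoetherianRing R] [IsLocalRing R] [IsDomain R] [IsIntegrallyClosed R],
    ringKrullDim R = 2 →
    ∀ (X : Scheme.{u}) (f : X ⟶ Spec (.of R)), IsResolution f →
    ∀ (W : Scheme.{u}) [IsIntegral W] (g : W ⟶ Spec (.of R)) [IsProper g], IsBirational g →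
      ∃ (Z : Scheme.{u}) (j : Z ⟶ X) (h : Z ⟶ W), IsResolution j ∧ h ≫ g = j ≫ f
-- TODO(general form): Theorem (26.1): for every surface `X` and every `S`-rational transformation
-- `φ : X ⇢ Y` (`Y` separated of finite type over `S`) there is `f : X' → X`, a succession of normalizations
-- and quadratic transformations, such that `φ ∘ f` is a morphism; B) with `j` literally a composite of point
-- blow-ups.

/-! ## Proposition (1.2) 2) modulo a domination (fact-free) -/

/-- Birationality of a factor: if `q : M → S` and `s ≫ q : Y → S` are birational, with `Y` and `M`
irreducible, then so is `s` (the tree's private `isBirational_of_comp'` of `ResolutionFactorsThroughBlowup`).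
[folklore] -/
private theorem isBirational_of_comp_of_isBirational'' {Y M S : Scheme.{u}} [IrreducibleSpace Y]
    [IrreducibleSpace M] {s : Y ⟶ M} {q : M ⟶ S} (hq : IsBirational q) (h : IsBirational (s ≫ q)) :
    IsBirational s := by
  obtain ⟨U₁, hU₁, -, hiso₁⟩ := h
  obtain ⟨U₂, hU₂, -, hiso₂⟩ := hq
  haveI : Nonempty S := ⟨q (Classical.arbitrary M)⟩
  have hne : ((U₁ ⊓ U₂ : S.Opens) : Set S).Nonempty := by
    rw [Opens.coe_inf, Set.inter_comm]
    exact hU₁.inter_open_nonempty U₂ U₂.2 hU₂.nonempty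
  haveI h₁ : IsIso ((s ≫ q) ∣_ (U₁ ⊓ U₂)) := isIso_morphismRestrict_of_le _ hiso₁ inf_le_left
  haveI h₂ : IsIso (q ∣_ (U₁ ⊓ U₂)) := isIso_morphismRestrict_of_le _ hiso₂ inf_le_right
  obtain ⟨x, hx⟩ := hne
  let y : ↥((s ≫ q) ⁻¹ᵁ (U₁ ⊓ U₂)) :=
    (Scheme.homeoOfIso (asIso ((s ≫ q) ∣_ (U₁ ⊓ U₂)))).symm ⟨x, hx⟩
  have hy : (y : Y) ∈ (s ≫ q) ⁻¹ᵁ (U₁ ⊓ U₂) := y.2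
  refine ⟨q ⁻¹ᵁ (U₁ ⊓ U₂), ?_, ?_, ?_⟩
  · exact (q ⁻¹ᵁ (U₁ ⊓ U₂)).2.dense
      ⟨s y, show q (s y) ∈ U₁ ⊓ U₂ by rw [← Scheme.Hom.comp_apply]; exact hy⟩
  · rw [← Scheme.Hom.comp_preimage]
    exact ((s ≫ q) ⁻¹ᵁ (U₁ ⊓ U₂)).2.dense ⟨y, hy⟩
  · haveI : IsIso (s ∣_ q ⁻¹ᵁ (U₁ ⊓ U₂) ≫ q ∣_ (U₁ ⊓ U₂)) := by
      rw [← morphismRestrict_comp]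
      exact h₁
    exact IsIso.of_isIso_comp_right (s ∣_ q ⁻¹ᵁ (U₁ ⊓ U₂)) (q ∣_ (U₁ ⊓ U₂))

/-- **Lipman 1969, Proposition (1.2) 2) MODULO a domination** (fact-free): for `R` a Noetherian domain of
Krull dimension `≤ 2`, a resolution `π : X → Spec R` with `H¹(X, 𝒪_X) = 0` (the witness of a rational
singularity), `g : W → Spec R` proper birational with `W` integral and NORMAL, and a common domination
`j : Z → X` (a resolution), `h : Z → W` with `h ≫ g = j ≫ π`: `H¹(W, 𝒪_W) = 0`.  Lipman's proof, p. 200: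
`H¹(Z, 𝒪_Z) = 0` by A) (`hasTrivialCechH1_comp_of_isRegular`), `h` is proper and birational, `h_*𝒪_Z = 𝒪_W`
since `W` is normal, and `H¹(W, 𝒪_W) ↪ H¹(Z, 𝒪_Z)` (`hasTrivialCechH1_of_isBirational_of_isIntegrallyClosed`).
[cite: Lipman1969, Proposition (1.2) 2), proof (p. 200)] -/
theorem hasTrivialCechH1_of_isBirational_of_dominated {R : Type u} [CommRing R] [IsNoetherianRing R]
    [IsDomain R] (hdim : ringKrullDim R ≤ 2) {X : Scheme.{u}} (π : X ⟶ Spec (.of R)) (hπ : IsResolution π)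
    (hH : HasTrivialCechH1 π) {W : Scheme.{u}} [IsIntegral W] (g : W ⟶ Spec (.of R)) [IsProper g]
    (hg : IsBirational g) (hWn : ∀ w : W, IsIntegrallyClosed (W.presheaf.stalk w))
    {Z : Scheme.{u}} (j : Z ⟶ X) (h : Z ⟶ W) (hj : IsResolution j) (hfac : h ≫ g = j ≫ π) :
    HasTrivialCechH1 g := by
  haveI : IsProper π := hπ.isProper
  haveI : IsProper j := hj.isProper
  haveI : IsIntegral X := hπ.isIntegral_source
  haveI : IsIntegral Z := hj.isIntegral_source
  haveI : IsNoetherian X := by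
    haveI : IsLocallyNoetherian X := LocallyOfFiniteType.isLocallyNoetherian π
    haveI : CompactSpace X := QuasiCompact.compactSpace_of_compactSpace π
    exact {}
  haveI : IsNoetherian Z := by
    haveI : IsLocallyNoetherian Z := LocallyOfFiniteType.isLocallyNoetherian (j ≫ π)
    haveI : CompactSpace Z := QuasiCompact.compactSpace_of_compactSpace (j ≫ π)
    exact {}
  -- `H¹(Z, 𝒪_Z) = 0` by A)
  have hZ : HasTrivialCechH1 (j ≫ π) :=
    hasTrivialCechH1_comp_of_isRegular π j hj.isBirational hj.isRegular hπ.isRegular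
      (ringKrullDim_stalk_le_two_of_isBirational hdim π hπ.isBirational) hH
  rw [← hfac] at hZ
  -- `h` is proper and birational; descend along `h_*𝒪_Z = 𝒪_W`
  haveI : IsProper (h ≫ g) := by rw [hfac]; infer_instance
  haveI : IsProper h := IsProper.of_comp h g
  have hh : IsBirational h :=
    isBirational_of_comp_of_isBirational'' hg (by rw [hfac]; exact hj.isBirational.comp hπ.isBirational)
  exact hasTrivialCechH1_of_isBirational_of_isIntegrallyClosed h g hh hWn hZ

/-! ## Proposition (1.2) 2) modulo B) -/

/-- **Lipman 1969, Proposition (1.2) 2), in print generality, MODULO statement B) of its proof**: «Let `R` be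
a two-dimensional normal local ring having a rational singularity, and let `g : W → Spec(R)` be a birational map
of finite type. … 2) If `W` is normal and `g` is proper then `H¹(W, 𝒪_W) = 0`.»  For `R` a normal Noetherian
local domain of Krull dimension `2` with `HasRationalSingularity R`, `W` integral with integrally closed local
rings and `g` proper birational: `HasTrivialCechH1 g`.  Everything but B) is proved
(`hasTrivialCechH1_of_isBirational_of_dominated`). [cite: Lipman1969, Proposition (1.2) 2) (p. 199) and its proof (p. 200)] -/
theorem Lipman1969_1_2_B.hasTrivialCechH1_of_isProper (hB : Lipman1969_1_2_B.{u}) {R : Type u} [CommRing R]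
    [IsNoetherianRing R] [IsLocalRing R] [IsDomain R] [IsIntegrallyClosed R] (hdim : ringKrullDim R = 2)
    (hrat : HasRationalSingularity R) {W : Scheme.{u}} [IsIntegral W] (g : W ⟶ Spec (.of R)) [IsProper g]
    (hg : IsBirational g) (hWn : ∀ w : W, IsIntegrallyClosed (W.presheaf.stalk w)) :
    HasTrivialCechH1 g := by
  obtain ⟨X, π, hπ, hH⟩ := hrat
  obtain ⟨Z, j, h, hj, hfac⟩ := hB R hdim X π hπ W g hg
  exact hasTrivialCechH1_of_isBirational_of_dominated hdim.le π hπ hH g hg hWn j h hj hfac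

/-- **Every desingularization of a rational surface singularity has `H¹ = 0`, MODULO B)** — the consumed shape
of `Lipman1969_1_2.hasTrivialCechH1_of_isResolution` with the named fact (1.2) replaced by statement B):
for `R` a normal Noetherian local domain of Krull dimension `2` with a rational singularity and any resolution
`π : X → Spec R`, `HasTrivialCechH1 π` (`X` is regular, hence normal; `π` is proper birational).
[cite: Lipman1969, Proposition (1.2) 2) (p. 199) and its proof (p. 200)] -/
theorem Lipman1969_1_2_B.hasTrivialCechH1_of_isResolution (hB : Lipman1969_1_2_B.{u}) {R : Type u}
    [CommRing R] [IsNoetherianRing R] [IsLocalRing R] [IsDomain R] [IsIntegrallyClosed R]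
    (hdim : ringKrullDim R = 2) (hrat : HasRationalSingularity R) {X : Scheme.{u}}
    (π : X ⟶ Spec (.of R)) (hπ : IsResolution π) : HasTrivialCechH1 π := by
  haveI : IsProper π := hπ.isProper
  haveI : IsIntegral X := hπ.isIntegral_source
  exact hB.hasTrivialCechH1_of_isProper hdim hrat π hπ.isBirational
    (fun x => by haveI := hπ.isRegular x; exact isIntegrallyClosed_of_isRegularLocalRing _)

end Literature.AlgebraicGeometry.Resolution

end
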